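import Mathlib
import HarnessLib
import Literature.Probability.LatticeModels.IsingLimitLaw
import Literature.Probability.LatticeModels.IsingLimitLawTilt
import Literature.Probability.LatticeModels.IsingLimitLawLaplace

/-!
# Gaussian-exponential moments from Laplace-transform bounds (helpers for stub `stub_moments`)

Line `telegraph-bessel-chain` of the crux `LeeYang.LeeyangPolyaKernelIsingLimit`
(stmt-RiemannHypothesis-0453), lead prover. A finite Ising magnetization law
`law = isingMagnetizationLaw n J w` (a finite mixture of Dirac masses) whose Laplace transform obeys
`∫ e^{hu} d(law) ≤ exp(A |h|^{3/2} + ε h²)` for all real `h` has Gaussian-exponential moments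
`∫ e^{bu²} d(law) ≤ C(A, b)` as soon as `8 b ε ≤ 1`, with a constant NOT depending on `ε` or on the
law. Proof: Hubbard–Stratonovich — `e^{bu²} = ∫ φ(g) e^{√(2b) u g} dg` with the standard normal
density `φ = gaussianPDFReal 0 1` (Mathlib `mgf_id_gaussianReal`), the finite sum over spin
configurations commutes with the `dg`-integral, and the majorant
`φ(g) exp(A (√(2b)|g|)^{3/2} + g²/4)` is Lebesgue integrable (`|x|^{3/2} ≤ R^{3/2} + x²/√R`).

* `integral_gaussianPDFReal_mul_exp` — `∫ φ(g) e^{cg} dg = e^{c²/2}` and integrability;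
* `abs_mul_sqrt_abs_le` — `|x|√|x| ≤ R√R + x²/√R`;
* `integral_exp_mul_sq_isingMagnetizationLaw_le_of_mgf_le` — the moment bound.

References: standard (Hubbard 1959 / Stratonovich 1957 identity; Newman, CPAM 27 (1974) §1 for the
role of `∫e^{bu²}` bounds). Everything here is proved.
-/

noncomputable section

namespace Summit.RiemannHypothesis.RiemannHypothesis.Theorems.LeeYangTelegraph

open MeasureTheory Filter Topology ProbabilityTheory
open Literature.Probability.LatticeModels

/-! ### The standard normal density against exponentials -/

/-- `∫ φ(g) e^{cg} dg = e^{c²/2}` for the standard normal density `φ = gaussianPDFReal 0 1`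
(the moment generating function of `N(0,1)`). [folklore] -/
theorem integral_gaussianPDFReal_mul_exp (c : ℝ) :
    ∫ g, gaussianPDFReal 0 1 g * Real.exp (c * g) = Real.exp (c ^ 2 / 2) := by
  have h := congrFun (mgf_id_gaussianReal (μ := (0 : ℝ)) (v := (1 : NNReal))) c
  rw [mgf, integral_gaussianReal_eq_integral_smul one_ne_zero] at h
  simpa [smul_eq_mul] using h

/-- `g ↦ φ(g) e^{cg}` is Lebesgue integrable. [folklore] -/
theorem integrable_gaussianPDFReal_mul_exp (c : ℝ) :
    Integrable fun g : ℝ => gaussianPDFReal 0 1 g * Real.exp (c * g) := by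
  have h := integrable_exp_mul_gaussianReal (μ := (0 : ℝ)) (v := (1 : NNReal)) c
  rw [gaussianReal_of_var_ne_zero 0 one_ne_zero, gaussianPDF_def,
    integrable_withDensity_iff_integrable_smul' (measurable_gaussianPDFReal 0 1).ennreal_ofReal
      (Eventually.of_forall fun _ => ENNReal.ofReal_lt_top)] at h
  refine h.congr (Eventually.of_forall fun g => ?_)
  simp only [ENNReal.toReal_ofReal (gaussianPDFReal_nonneg 0 1 g), smul_eq_mul]

/-- **Hubbard–Stratonovich**: `e^{bu²} = ∫ φ(g) e^{(√(2b) u) g} dg` for `b ≥ 0`. [folklore] -/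
theorem exp_mul_sq_eq_integral {b : ℝ} (hb : 0 ≤ b) (u : ℝ) :
    Real.exp (b * u ^ 2) = ∫ g, gaussianPDFReal 0 1 g * Real.exp (Real.sqrt (2 * b) * u * g) := by
  rw [integral_gaussianPDFReal_mul_exp]
  congr 1
  rw [mul_pow, Real.sq_sqrt (by positivity)]
  ring

/-! ### An elementary inequality -/

/-- `|x| √|x| ≤ R √R + x² / √R` for `R > 0` (split at `|x| = R`). [folklore] -/
theorem abs_mul_sqrt_abs_le (x : ℝ) {R : ℝ} (hR : 0 < R) :
    |x| * Real.sqrt |x| ≤ R * Real.sqrt R + x ^ 2 / Real.sqrt R := by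
  have hx := abs_nonneg x
  have hsR := Real.sqrt_pos.2 hR
  rcases le_or_gt |x| R with h | h
  · have h1 : |x| * Real.sqrt |x| ≤ R * Real.sqrt R :=
      mul_le_mul h (Real.sqrt_le_sqrt h) (Real.sqrt_nonneg _) hR.le
    have h2 : 0 ≤ x ^ 2 / Real.sqrt R := by positivity
    linarith
  · -- `|x| > R`: `|x|√|x| = x²/√|x| ≤ x²/√R`
    have hsx : Real.sqrt R ≤ Real.sqrt |x| := Real.sqrt_le_sqrt h.le
    have hsx0 : 0 < Real.sqrt |x| := hsR.trans_le hsx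
    have h1 : |x| * Real.sqrt |x| = x ^ 2 / Real.sqrt |x| := by
      rw [eq_div_iff hsx0.ne', mul_assoc, Real.mul_self_sqrt hx, ← sq_abs, sq]
    have h2 : x ^ 2 / Real.sqrt |x| ≤ x ^ 2 / Real.sqrt R :=
      div_le_div_of_nonneg_left (sq_nonneg x) hsR hsx
    have h3 : 0 ≤ R * Real.sqrt R := by positivity
    linarith

/-! ### The majorant is integrable -/

/-- For `A ≥ 0`, `t ≥ 0`: `g ↦ φ(g) exp(A (t|g|)√(t|g|) + g²/4)` is Lebesgue integrable (it is
`≤ const · e^{−g²/8}`). [folklore] -/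
theorem integrable_majorant {A t : ℝ} (hA : 0 ≤ A) (ht : 0 ≤ t) :
    Integrable fun g : ℝ => gaussianPDFReal 0 1 g *
      Real.exp (A * ((t * |g|) * Real.sqrt (t * |g|)) + g ^ 2 / 4) := by
  -- choose `R` with `A t √t / √R ≤ 1/8`
  set K : ℝ := A * (t * Real.sqrt t) with hK
  have hK0 : 0 ≤ K := by positivity
  set R : ℝ := (8 * K + 1) ^ 2 with hRdef
  have hR : 0 < R := by positivity
  have hsR : Real.sqrt R = 8 * K + 1 := by
    rw [hRdef, Real.sqrt_sq (by positivity)]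
  have hKR : K / Real.sqrt R ≤ 1 / 8 := by
    rw [hsR, div_le_div_iff₀ (by positivity) (by norm_num)]
    nlinarith
  -- pointwise bound of the exponent
  have hpt : ∀ g : ℝ, A * ((t * |g|) * Real.sqrt (t * |g|)) + g ^ 2 / 4 ≤
      K * (R * Real.sqrt R) + 3 / 8 * g ^ 2 := by
    intro g
    have h1 : (t * |g|) * Real.sqrt (t * |g|) = t * Real.sqrt t * (|g| * Real.sqrt |g|) := by
      rw [Real.sqrt_mul ht]; ring
    have h2 := abs_mul_sqrt_abs_le g hR
    have h3 : A * ((t * |g|) * Real.sqrt (t * |g|)) = K * (|g| * Real.sqrt |g|) := by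
      rw [h1, hK]; ring
    rw [h3]
    have h4 : K * (|g| * Real.sqrt |g|) ≤ K * (R * Real.sqrt R + g ^ 2 / Real.sqrt R) :=
      mul_le_mul_of_nonneg_left h2 hK0
    have h5 : K * (g ^ 2 / Real.sqrt R) = K / Real.sqrt R * g ^ 2 := by ring
    have h6 : K / Real.sqrt R * g ^ 2 ≤ 1 / 8 * g ^ 2 :=
      mul_le_mul_of_nonneg_right hKR (sq_nonneg g)
    nlinarith
  -- the Gaussian majorant `const · exp(-(1/8) g²)`
  have hmaj : Integrable fun g : ℝ => (Real.sqrt (2 * Real.pi * (1 : NNReal)))⁻¹ *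
      Real.exp (K * (R * Real.sqrt R)) * Real.exp (-(1 / 8) * g ^ 2) :=
    (integrable_exp_neg_mul_sq (by norm_num : (0 : ℝ) < 1 / 8)).const_mul _
  refine hmaj.mono' ?_ (Eventually.of_forall fun g => ?_)
  · refine ((measurable_gaussianPDFReal 0 1).mul ?_).aestronglyMeasurable
    refine Measurable.exp ?_
    fun_prop
  rw [Real.norm_of_nonneg (mul_nonneg (gaussianPDFReal_nonneg 0 1 g) (Real.exp_pos _).le),
    gaussianPDFReal]
  simp only [NNReal.coe_one, mul_one, sub_zero]
  rw [mul_assoc (Real.sqrt (2 * Real.pi))⁻¹ (Real.exp (K * (R * Real.sqrt R))), ← Real.exp_add]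
  have hexp : Real.exp (-g ^ 2 / 2) * Real.exp (A * ((t * |g|) * Real.sqrt (t * |g|)) + g ^ 2 / 4) ≤
      Real.exp (K * (R * Real.sqrt R) + -(1 / 8) * g ^ 2) := by
    rw [← Real.exp_add]
    refine Real.exp_le_exp.2 ?_
    have := hpt g
    nlinarith
  calc (Real.sqrt (2 * Real.pi))⁻¹ * Real.exp (-g ^ 2 / 2) *
        Real.exp (A * ((t * |g|) * Real.sqrt (t * |g|)) + g ^ 2 / 4)
      = (Real.sqrt (2 * Real.pi))⁻¹ * (Real.exp (-g ^ 2 / 2) *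
        Real.exp (A * ((t * |g|) * Real.sqrt (t * |g|)) + g ^ 2 / 4)) := by ring
    _ ≤ (Real.sqrt (2 * Real.pi))⁻¹ * Real.exp (K * (R * Real.sqrt R) + -(1 / 8) * g ^ 2) :=
        mul_le_mul_of_nonneg_left hexp (by positivity)

/-! ### The moment bound -/

/-- **Gaussian-exponential moments from a Laplace bound.** If a finite magnetization law has
`∫ e^{hu} ≤ exp(A|h|√|h| + ε h²)` for all real `h`, then for `b > 0` with `8bε ≤ 1`,
`∫ e^{bu²} ≤ ∫ φ(g) exp(A(√(2b)|g|)√(√(2b)|g|) + g²/4) dg` — a constant independent of `ε` and of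
the law. [folklore] -/
theorem integral_exp_mul_sq_isingMagnetizationLaw_le_of_mgf_le {n : ℕ} (J : Fin n → Fin n → ℝ)
    (w : Fin n → ℝ) {A ε b : ℝ} (hA : 0 ≤ A) (hb : 0 < b) (hbε : 8 * b * ε ≤ 1)
    (hmgf : ∀ h : ℝ, ∫ u, Real.exp (h * u) ∂(isingMagnetizationLaw n J w : Measure ℝ) ≤
      Real.exp (A * (|h| * Real.sqrt |h|) + ε * h ^ 2)) :
    ∫ u, Real.exp (b * u ^ 2) ∂(isingMagnetizationLaw n J w : Measure ℝ) ≤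
      ∫ g, gaussianPDFReal 0 1 g *
        Real.exp (A * ((Real.sqrt (2 * b) * |g|) * Real.sqrt (Real.sqrt (2 * b) * |g|)) + g ^ 2 / 4) := by
  set t : ℝ := Real.sqrt (2 * b) with ht
  have ht0 : 0 ≤ t := Real.sqrt_nonneg _
  set μ : Measure ℝ := (isingMagnetizationLaw n J w : Measure ℝ) with hμ
  -- Step 1: `∫ e^{bu²} dμ = ∫ φ(g) (∫ e^{(tg)u} dμ(u)) dg` (finite sum ↔ integral)
  have hsum : ∀ (F : ℝ → ℝ), Continuous F → ∫ u, F u ∂μ =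
      ∑ s : Fin n → Bool, (isingBoltzmann J s / isingPairPartition J) * F (weightedMagnetization w s) := by
    intro F hF
    rw [hμ, integral_isingMagnetizationLaw_eq_sum J w hF.stronglyMeasurable]
    simp only [smul_eq_mul]
  have hstep1 : ∫ u, Real.exp (b * u ^ 2) ∂μ =
      ∫ g, gaussianPDFReal 0 1 g * ∫ u, Real.exp ((t * g) * u) ∂μ := by
    rw [hsum _ (by fun_prop)]
    have hin : ∀ g : ℝ, gaussianPDFReal 0 1 g * ∫ u, Real.exp ((t * g) * u) ∂μ =
        ∑ s : Fin n → Bool, (isingBoltzmann J s / isingPairPartition J) *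
          (gaussianPDFReal 0 1 g * Real.exp ((t * weightedMagnetization w s) * g)) := by
      intro g
      rw [hsum _ (by fun_prop), Finset.mul_sum]
      refine Finset.sum_congr rfl fun s _ => ?_
      ring_nf
    simp_rw [hin]
    rw [integral_finsetSum _ fun s _ => (integrable_gaussianPDFReal_mul_exp _).const_mul _]
    refine Finset.sum_congr rfl fun s _ => ?_
    rw [integral_const_mul, exp_mul_sq_eq_integral hb.le]
  rw [hstep1]
  -- Step 2: pointwise bound of the inner integral and `integral_mono`
  have hinner_int : Integrable fun g : ℝ => gaussianPDFReal 0 1 g * ∫ u, Real.exp ((t * g) * u) ∂μ := by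
    have : (fun g : ℝ => gaussianPDFReal 0 1 g * ∫ u, Real.exp ((t * g) * u) ∂μ) =
        fun g => ∑ s : Fin n → Bool, (isingBoltzmann J s / isingPairPartition J) *
          (gaussianPDFReal 0 1 g * Real.exp ((t * weightedMagnetization w s) * g)) := by
      funext g
      rw [hsum _ (by fun_prop), Finset.mul_sum]
      refine Finset.sum_congr rfl fun s _ => ?_
      ring_nf
    rw [this]
    exact integrable_finsetSum _ fun s _ => (integrable_gaussianPDFReal_mul_exp _).const_mul _
  refine integral_mono hinner_int (integrable_majorant hA ht0) fun g => ?_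
  refine mul_le_mul_of_nonneg_left ?_ (gaussianPDFReal_nonneg 0 1 g)
  refine (hmgf (t * g)).trans (Real.exp_le_exp.2 ?_)
  have habs : |t * g| = t * |g| := by rw [abs_mul, abs_of_nonneg ht0]
  rw [habs]
  have hε' : ε * (t * g) ^ 2 ≤ g ^ 2 / 4 := by
    rw [mul_pow, ht, Real.sq_sqrt (by positivity)]
    nlinarith [sq_nonneg g]
  linarith

end Summit.RiemannHypothesis.RiemannHypothesis.Theorems.LeeYangTelegraph

end
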